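import Summits.QuantumFields.YangMills.Theorems.BalabanUVNodesN21ShellSplitOfRecord13CoPHDefs

/-!
# N21 (NE7c) · THE SELECTED TOP CUT ON THE THRESHOLD-LETTER ROAD — definition lane: a run's (2.18) terms of record RE-LETTERED AT THE TOP STEP ONLY (front factor
# `χ_K^{θ}` AND the (3.2) weight of the last 𝐓-step at the SAME letter `θ`, def-T FILE 19 «ONE letter»), their class weights and their BANDS below the letter

R134 seat `pub-ymgap-dag-n21-d` (g10), node N21 = NE7c (NOT PRINTED; NOT proved at print's fixed thresholds), strategy s2; lane K3⁷ `SpineGivenEndpointR13SepCoPH`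
(stmt-QuantumFields-20544, `--supports … --as helper`; COUNT-NEUTRAL).  DEFINITION LANE: five `def`s + faces; NO estimate.  Imports g9's definition lane
`…N21ShellSplitOfRecord13CoPHDefs` (p591252 + v1.1∕v1.2; through it n20-d's reading, F3's `dressedSlotsOfDatum₉` and def-T's FILE 19 `Node00/StepWeightsAtThresholds`:
`ThresholdLetter`, `chiSeqOfRecordAt`, `wOfRecordAt`, `tstepOfRecordAt`).  Companion (theorems): `…N21SelectedTopCut13CoPH` (with this seat's `cutGrid`, p604430).
[III] = [Balaban1988Convergent], [LF-I] = [Balaban1989LargeFieldI].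

WHY (the consumer of the selected cut, A6).  At the READING OF RECORD the terms carry their sharp top cut at print's `ε_K`, so a selected band below `ε_K` is adjacent to
the terms' cut only at depth `0` (this seat's `…ShellSplitSelected13CoPHKeyed`, header).  The selected cut is CONTENT for terms whose top (2.17) front factor AND last
(3.2) decomposition read the SELECTED letter `θ` — [LF-I] p. 181: «for these we change the regularity conditions by a factor» (the printed threshold ladders are not
sharp numbers).  THIS FILE types exactly those terms, touching NOTHING below the top step: the run's dressed level-`k` slots OF RECORD (`dressedSlotsOfDatum₉ … k`,
`k + 1 = K`), 𝐓-stepped ONCE with def-T's step weights AT THE LETTER `topLetter ν θ` (`= ε_j` for `j ≠ K`, `= θ` at `j = K`) and read against the top front factor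
`χ_K^{θ}`.  By def-T's unity at letters (`isStepUnity_wOfRecordAt`) and `isRT_tstepOfRecordAt` the assembled top-lettered density is an RT-image of the record's
level-`k` density FOR EVERY `θ` (companion §17): the top-lettered terms re-sum to the SAME partition function — a legitimate (2.18) representation of the run at the top,
pre-𝐑 ([LF-I] (0.3)'s top 𝐑-step is omitted: it preserves the integral, (0.4), and at the identity selector multiplies each slot by a `{0,1}` ratio,
`Node00.rstepOfSel_id_TexpA`).

WHAT IS DEFINED (NODE 00's generality `ϑ D g₀ os p g k`; the top is level `k + 1`, meant at `k + 1 = p.K`).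
* `topLetter ν θ : ThresholdLetter` — `(p, g, j) ↦ if j = p.K then θ else ε_j`; faces `topLetter_top ∕ topLetter_of_ne`.
* `wTopAt ϑ θ` — def-T's `wOfRecordAt (topLetter ϑ.ν θ) (twoDeltaLetterOfRecord ϑ.ν ϑ.A₁) ϑ.ζ` (the (3.2) letter of the LAST step re-lettered, (3.3) letters of record).
* ★ `topSlotAt ϑ D g₀ os p g k θ t s′` — THE TOP-LETTERED (pre-𝐑) SLOT of a top history `s′`: `tstepOfRecordAt (topLetter ϑ.ν θ) (wTopAt ϑ θ) p g k (dressedSlotsOfDatum₉ … t p g k) s′`.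
* `topClassWeightAt … θ t s′ := ∫ χ_{k+1}^{θ}(s′)·topSlot^{θ}_{s′}` and ★ `topBandWeightAt … θ θ′ t s′ := ∫ χ_{k+1}^{θ}(s′)(1 − χ_{k+1}^{θ′}(s′))·topSlot^{θ}_{s′}` — the
  top-lettered term and its band between the letters `θ′ ≤ θ` (ADJACENT to the term's own cut `θ`).

HONEST FRAMING (binding).  Definitions; NO estimate; nothing below the top step is re-lettered (older thresholds, the (3.3) letters, the ℝ-side and the selector are
print's ∕ the record's); the top 𝐑-step is omitted (documented above); `θ` is a LETTER (the companion selects it per `(K, t)` by pigeonhole); no lettered spine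
READING is typed here (n20-d's `crOfRecord₁₃At` pins print's `ε_K` — a lettered reading and the K3 skeleton's `PinnedAtLive` admitting it are LOCATED, plan ∕ n20-d);
no `Provisos` inhabitant claimed (K0⁷ open); NE7c NOT PRINTED ∕ NOT proved at print's thresholds; N21 NOT discharged; K3⁷ NOT claimed; counts UNMOVED (typed 28∕28 ·
discharged 5∕27); never a count claim.  No `sorry`, no `axiom`, no `instance`, no `notation`.  One finite four-torus programme at fixed `ε` — NOT ℝ⁴, NOT OS, NOT a
mass gap, NOT the Clay problem.
-/

noncomputable section

open scoped BigOperators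
open Finset MeasureTheory

namespace Summit.QuantumFields.YangMills.Theorems.N21ShellSplitOfRecord13CoPH

open Literature.MathematicalPhysics.QuantumFieldTheory.Balaban1983to89
open Literature.MathematicalPhysics.QuantumFieldTheory.Balaban1983to89.T4Continuum
open Literature.MathematicalPhysics.QuantumFieldTheory.Balaban1983to89.Node00

/-! ## §16 The top letter, the top-lettered step weights, slot, class weight and band -/

section TopLettered

variable (F : T4Family) (N : ℕ) [NeZero N]

variable {F} in
/-- **THE TOP LETTER**: the threshold letter reading `θ` at the run's top level `j = p.K` and print's `ε_j = epsOfRecord ν g j` at every other level. [bookkeeping] -/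
def topLetter (ν : Stage7Numerics) (θ : ℝ) : ThresholdLetter :=
  fun p g j => if j = p.K then θ else epsOfRecord ν g j

variable {F} in
/-- Face: at the top level the top letter reads `θ`. [bookkeeping] -/
@[simp] theorem topLetter_top (ν : Stage7Numerics) (θ : ℝ) (p : B12.RunParams) (g : ℕ → ℝ) : topLetter ν θ p g p.K = θ := by
  simp [topLetter]

variable {F} in
/-- Face: off the top level the top letter reads print's `ε_j`. [bookkeeping] -/
theorem topLetter_of_ne (ν : Stage7Numerics) (θ : ℝ) (p : B12.RunParams) (g : ℕ → ℝ) {j : ℕ} (hj : j ≠ p.K) :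
    topLetter ν θ p g j = epsOfRecord ν g j := by
  simp [topLetter, hj]

/-- **THE TOP-LETTERED STEP WEIGHTS**: def-T's step weights at letters with the (3.2) letter `topLetter ν θ` (so ONLY the last step `p.K − 1 → p.K` reads `θ`) and the
(3.3) letters of record `2δ_j`. [bookkeeping] -/
def wTopAt (ϑ : Stage9Params F N) (θ : ℝ) : StepWeightsOfRecord F N ϑ.ν ϑ.τ9.M :=
  wOfRecordAt F N ϑ.ν ϑ.τ9.M (topLetter ϑ.ν θ) (twoDeltaLetterOfRecord ϑ.ν ϑ.A₁) ϑ.ζ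

variable (ϑ : Stage9Params F N) (D : FiniteEpsData F (SU N)) (g₀ : ℕ → ℝ) (os : List (ULoop F)) (p : B12.RunParams) (g : ℕ → ℝ) (k : ℕ)

/-- ★ **THE TOP-LETTERED (pre-𝐑) SLOT** of a level-`(k+1)` history `s′` at source `t`: the 𝐓-step AT THE LETTER `topLetter ϑ.ν θ` (old front factor `χ_k` at its
letter, step weights `wTopAt ϑ θ`) of the run's dressed level-`k` slots OF RECORD `dressedSlotsOfDatum₉ … t p g k` — nothing below the top step re-lettered. [bookkeeping] -/
def topSlotAt (θ t : ℝ) (s' : SeqOfRecord F ϑ.ν ϑ.τ9.M g p.K (k + 1)) : GaugeField (F.P p.K) (k + 1) (SU N) → ℝ :=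
  tstepOfRecordAt F N ϑ.ν ϑ.τ9.M (topLetter ϑ.ν θ) (wTopAt F N ϑ θ) p g k (dressedSlotsOfDatum₉ F N ϑ D g₀ os t p g k) s'

/-- **THE TOP-LETTERED CLASS WEIGHT** of `s′`: `∫ χ_{k+1}^{θ}(Ω_{k+1}(s′))·topSlot^{θ}(s′) dV`. [bookkeeping] -/
def topClassWeightAt (θ t : ℝ) (s' : SeqOfRecord F ϑ.ν ϑ.τ9.M g p.K (k + 1)) : ℝ :=
  ∫ V, chiSeqOfRecordAt F N ϑ.ν ϑ.τ9.M g p.K (k + 1) θ s' V * topSlotAt F N ϑ D g₀ os p g k θ t s' V ∂fieldMeasure (F.P p.K) (k + 1) (SU N)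

/-- ★ **THE TOP-LETTERED BAND** of `s′` between the letters `θ′ ≤ θ`: `∫ χ_{k+1}^{θ}(s′)·(1 − χ_{k+1}^{θ′}(s′))·topSlot^{θ}(s′) dV` — the part of the top-lettered
term on which every top cube of `Ω_{k+1}(s′)` passes at `θ` and some fails at `θ′`: ADJACENT to the term's own cut (T4IndicatorShell design (i)'s single-run shell at
relative width `1 − θ′∕θ`). [bookkeeping] -/
def topBandWeightAt (θ θ' t : ℝ) (s' : SeqOfRecord F ϑ.ν ϑ.τ9.M g p.K (k + 1)) : ℝ :=
  ∫ V, chiSeqOfRecordAt F N ϑ.ν ϑ.τ9.M g p.K (k + 1) θ s' V * (1 - chiSeqOfRecordAt F N ϑ.ν ϑ.τ9.M g p.K (k + 1) θ' s' V) *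
    topSlotAt F N ϑ D g₀ os p g k θ t s' V ∂fieldMeasure (F.P p.K) (k + 1) (SU N)

/-- Unfolding of the top-lettered slot through def-T's `tstepOfRecordAt_apply`: the transport of `w^{θ}(s′)(U,V)·(χ_k|_{topLetter … k}(init s′)(U)·slot_k(init s′)(U))`.
[bookkeeping] -/
theorem topSlotAt_apply (θ t : ℝ) (s' : SeqOfRecord F ϑ.ν ϑ.τ9.M g p.K (k + 1)) (V : GaugeField (F.P p.K) (k + 1) (SU N)) :
    topSlotAt F N ϑ D g₀ os p g k θ t s' V =
      transportOfRecord F N p.K k (fun U => wTopAt F N ϑ θ p g k s' U V *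
        (chiSeqOfRecordAt F N ϑ.ν ϑ.τ9.M g p.K k (topLetter ϑ.ν θ p g k) s'.init U * dressedSlotsOfDatum₉ F N ϑ D g₀ os t p g k s'.init U)) V :=
  tstepOfRecordAt_apply F N ϑ.ν ϑ.τ9.M (topLetter ϑ.ν θ) (wTopAt F N ϑ θ) p g k _ s' V

end TopLettered

end Summit.QuantumFields.YangMills.Theorems.N21ShellSplitOfRecord13CoPH

end
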